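/-
Copyright (c) 2026 the pub-hodgecm-mathlib formalisation cell (harness21).  Prover seat hodgecm-mathlib-K2E1-p08 (g3), Track B ∕ K2-LIT
(build stream 29), h413 = `stmt-HodgeConjecture-24833`, line `K2_E1_TraceFormulaBeta`, row 10 (DEAL F ∕ G1, last rung: the test space `TGt` is ε-STABLE);
dealer K2E1-plan (g2) RULING «G1 GO» 2026-09-04T01:27:06Z.  2026-09-04.
-/
import Summits.HodgeConjecture.HodgeConjecture.Theorems.K2E1TwistEpsilonLevels   -- ★ p856539 (K2E1-p08 g3): `eventually_twistLocal_mem_localLevelGt_iff` (brings ★ p856522, ★ TwistedDefs)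
import Summits.HodgeConjecture.HodgeConjecture.Theorems.K2E1TwistEpsilonArch     -- ★ p856622 (K2E1-p08 g3): the archimedean clauses, `toMixed_twistAdelic`
import HarnessLib

/-!
# h413 ∕ Track B «K2-LIT», line `K2_E1_TraceFormulaBeta`, row 10 (G1, last rung) — `K2E1GlobalTestFunctionsTwistStable`: THE SPACE OF TWISTED PURE TENSORS IS ε-STABLE —
# for every `φ = φ_∞ ⊗ ⊗'_v φ_v` on `G̃(𝔸_F) = GL_n(𝔸_E)` there is a pure tensor `ψ` (`ψ_∞ = φ_∞ ∘ ε_∞`, `ψ_v = φ_v ∘ ε_v`) with `toAdelicGt ψ = toAdelicGt φ ∘ ε`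

Cell `pub/hodgecm-mathlib`, crux H413 = `stmt-HodgeConjecture-24833`, route of record `HCCMUnconditional`; chair K2-lead (g0), dealer K2E1-plan (g2) (RULING «G1 GO»
2026-09-04T01:27:06Z; the «NOT HERE (next rung)» item of ★ `K2E1GlobalTestFunctionsTwistedDefs`: «`twist : GlobalTestFunctionGt → GlobalTestFunctionGt` with `toAdelicGt (twist φ) =
toAdelicGt φ ∘ ε`»).  Stated as an EXISTENCE THEOREM (no new `def`, kernel lane — a bundling `def twist` would only be `Classical.choose` of it, or the same structure literal in a
review-queued Defs leaf): the test space `{toAdelicGt φ}` of ★ `TwistedComparisonData.TGt` ∕ the `φ` of the twisted trace formula [Rogawski1990 §2.1 p. 12 «`(ρ(ε)φ)(g) = φ(ε⁻¹(g))`»,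
§4.10] is stable under `f ↦ f ∘ ε` (`ε⁻¹ = ε`).  The witness `ψ` is the componentwise twist: `ψ_∞ := φ_∞ ∘ ε_∞` is continuous, compactly supported and smooth in the archimedean
variable (★ p856622 `arch_comp_twist_clauses`); `ψ_v := φ_v ∘ ε_v` is locally constant with compact support (`ε_v` an involutive homeomorphism, ★ p856522 `twistLocal_twistLocal`) and
`= 𝟙_{K_v}` for almost all `v` (★ p856539 `eventually_twistLocal_mem_localLevelGt_iff`); and `toAdelicGt ψ g = toAdelicGt φ (ε g)` because `(ε g)_∞ = ε_∞(g_∞)` (★ p856622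
`toMixed_twistAdelic`) and `(ε g)_v = ε_v(g_v)` (★ `locCompGt_twistAdelic`).  Hypotheses: `c² = 1`, `E ∕ F` quadratic with `c δ = −δ ≠ 0` (the local involution), `Φ` `c`-hermitian —
all discharged at the CM pair.  THEOREMS ONLY (no `def`, no `instance`, no `notation`, no named-fact hypothesis, no `sorry`); lane `--kind proof --supports stmt-HodgeConjecture-24833
--as helper`.

HONEST LABEL.  Count-neutral helper; closes no socket by itself; HC_CM is proved only modulo the 7 printed citations (2 remaining named inputs: hLiu418 =
`stmt-HodgeConjecture-24832`, h413 = `stmt-HodgeConjecture-24833`) until rung 0 closes.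

## References
* [Rogawski1990] J. D. Rogawski, *Automorphic Representations of Unitary Groups in Three Variables* (1990), §2.1 p. 12, §4.7 p. 47, §4.10 p. 57, §13.5 p. 205.
* [BorelJacquet1979] A. Borel, H. Jacquet, *Automorphic forms and automorphic representations*, PSPM 33.1 (1979), §4.1 (`f = f_∞ ⊗ f^∞`, `f_v = 𝟙_{K_v}` a.e.).
-/

set_option autoImplicit false
-- the mandated namespace repeats `HodgeConjecture.HodgeConjecture`, as in every `Theorems/*.lean` of this sub-problem
set_option linter.dupNamespace false

noncomputable section

open NumberField NumberField.mixedEmbedding IsDedekindDomain Set Filter Topology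
open scoped MatrixGroups Matrix Classical

namespace Summit.HodgeConjecture.HodgeConjecture.Cruxes.H413.K2E1GlobalTestFunctionsTwistStable

open Literature.NumberTheory.Automorphic Literature.NumberTheory.Automorphic.UnitaryGroup
open Literature.NumberTheory.Rogawski1990 (IsLocSmooth)
open Literature.NumberTheory.Rogawski1990.Ch4Sec10 (unitaryTwist)
open Summit.HodgeConjecture.HodgeConjecture.Cruxes.H413.K2E1GlobalTestFunctionsTwisted
open Summit.HodgeConjecture.HodgeConjecture.Cruxes.H413.K2E1TwistEpsilonInvolution
open Summit.HodgeConjecture.HodgeConjecture.Cruxes.H413.K2E1TwistEpsilonLevels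
open Summit.HodgeConjecture.HodgeConjecture.Cruxes.H413.K2E1TwistEpsilonArch

variable {F : Type} (E : Type) [Field F] [NumberField F] [Field E] [NumberField E] [Algebra F E] (n : ℕ) (Φ : GL (Fin n) E) (c : E ≃ₐ[F] E)

/-- **The local factor `φ_v ∘ ε_v` is locally constant with compact support** (`ε_v` continuous ★ `continuous_twistLocal`; an involution ★ p856522 `twistLocal_twistLocal`, hence a
homeomorphism, so compact support pulls back). [cite: Rogawski1990, §4.10 p. 57] -/
theorem isLocSmooth_comp_twistLocal [Algebra.IsQuadraticExtension F E] {δ : E} (hcδ : c δ = -δ) (hδ : δ ≠ 0)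
    (hΦ : ((Φ : GL (Fin n) E) : Matrix (Fin n) (Fin n) E)ᵀ.map c = (Φ : Matrix (Fin n) (Fin n) E)) (v : HeightOneSpectrum (𝓞 F))
    {f : GL (Fin n) (LocalRing E v) → ℂ} (hf : IsLocSmooth f) : IsLocSmooth (f ∘ twistLocal E n Φ c v) := by
  let e : GL (Fin n) (LocalRing E v) ≃ₜ GL (Fin n) (LocalRing E v) :=
    { toFun := twistLocal E n Φ c v
      invFun := twistLocal E n Φ c v
      left_inv := twistLocal_twistLocal E n Φ c hcδ hδ hΦ v
      right_inv := twistLocal_twistLocal E n Φ c hcδ hδ hΦ v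
      continuous_toFun := continuous_twistLocal E n Φ c v
      continuous_invFun := continuous_twistLocal E n Φ c v }
  exact ⟨hf.1.comp_continuous (continuous_twistLocal E n Φ c v), hf.2.comp_homeomorph e⟩

/-- **The unramified clause a.e.**: `φ_v ∘ ε_v = 𝟙_{K_v}` for almost all `v` whenever `φ_v = 𝟙_{K_v}` for almost all `v` (★ p856539 `eventually_twistLocal_mem_localLevelGt_iff`).
[cite: Rogawski1990, §4.10 p. 57] [cite: BorelJacquet1979, §4.1] -/
theorem eventually_comp_twistLocal_eq_indicator (φ : GlobalTestFunctionGt F E n) :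
    ∀ᶠ v : HeightOneSpectrum (𝓞 F) in cofinite,
      φ.fin v ∘ twistLocal E n Φ c v = (localLevelGt E n v : Set (GL (Fin n) (LocalRing E v))).indicator 1 := by
  filter_upwards [φ.fin_eventually_eq_indicator, eventually_twistLocal_mem_localLevelGt_iff E n Φ c] with v hv hε
  funext g
  rw [Function.comp_apply, hv]
  by_cases hg : g ∈ localLevelGt E n v
  · rw [Set.indicator_of_mem ((hε g).2 hg), Set.indicator_of_mem hg, Pi.one_apply, Pi.one_apply]
  · rw [Set.indicator_of_notMem (fun h => hg ((hε g).1 h)), Set.indicator_of_notMem hg]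

/-- **THE SPACE OF TWISTED PURE TENSORS IS ε-STABLE.**  For `c² = 1`, `E ∕ F` quadratic (`c δ = −δ`, `δ ≠ 0`) and a `c`-hermitian `Φ ∈ GL_n(E)`, every pure tensor `φ` on `GL_n(𝔸_E)`
(★ `GlobalTestFunctionGt F E n`) has a COMPONENTWISE TWIST `ψ` — a pure tensor with `ψ_∞ = φ_∞ ∘ ε_∞` (`ε_∞` the archimedean twist with `Φ_∞ = (Φ ⊗ 1)_∞`) and `ψ_v = φ_v ∘ ε_v` for every
finite `v` — and **`toAdelicGt ψ g = toAdelicGt φ (ε g)`** for all `g` (`ε = twistAdelic F E n Φ c`): the print's «`ρ(ε)φ`» is again a test function of the same kind.  (`ψ` is the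
structure literal; no definition is introduced.) [cite: Rogawski1990, §2.1 p. 12; §4.10 p. 57; §13.5 p. 205] [cite: BorelJacquet1979, §4.1] -/
theorem exists_twist_toAdelicGt_comp (hc : c * c = 1) [Algebra.IsQuadraticExtension F E] {δ : E} (hcδ : c δ = -δ) (hδ : δ ≠ 0)
    (hΦ : ((Φ : GL (Fin n) E) : Matrix (Fin n) (Fin n) E)ᵀ.map c = (Φ : Matrix (Fin n) (Fin n) E)) (φ : GlobalTestFunctionGt F E n) :
    ∃ ψ : GlobalTestFunctionGt F E n,
      ψ.arch = φ.arch ∘ unitaryTwist (conjMixed F E c) (GLn.toMixed n E (formAdelic E n Φ)) ∧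
      (∀ v : HeightOneSpectrum (𝓞 F), ψ.fin v = φ.fin v ∘ twistLocal E n Φ c v) ∧
      ∀ g : GL (Fin n) (AdeleRing (𝓞 E) E), toAdelicGt ψ g = toAdelicGt φ (twistAdelic F E n Φ c g) := by
  obtain ⟨hcont, hsupp, hsmooth⟩ := arch_comp_twist_clauses F E n c Φ hc hΦ φ.continuous_arch φ.hasCompactSupport_arch φ.isArchSmooth_arch
  refine ⟨{ arch := φ.arch ∘ unitaryTwist (conjMixed F E c) (GLn.toMixed n E (formAdelic E n Φ))
            continuous_arch := hcont
            hasCompactSupport_arch := hsupp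
            isArchSmooth_arch := hsmooth
            fin := fun v => φ.fin v ∘ twistLocal E n Φ c v
            isLocSmooth_fin := fun v => isLocSmooth_comp_twistLocal E n Φ c hcδ hδ hΦ v (φ.isLocSmooth_fin v)
            fin_eventually_eq_indicator := eventually_comp_twistLocal_eq_indicator E n Φ c φ }, rfl, fun v => rfl, fun g => ?_⟩
  rw [toAdelicGt_apply, toAdelicGt_apply, toMixed_twistAdelic]
  congr 1
  refine finprod_congr fun v => ?_
  rw [locGt_apply, locGt_apply]
  change φ.fin v (twistLocal E n Φ c v (locCompGt E n v g)) = φ.fin v (locCompGt E n v (twistAdelic F E n Φ c g))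
  rw [locCompGt_twistAdelic]

/-- **Corollary (the shape consumed by ★ `TwistedComparisonData.TGt` ∕ `twistFun`)**: the image of `toAdelicGt` is stable under `f ↦ f ∘ ε` (★ `twistFun (twistAdelic …)`).
[cite: Rogawski1990, §2.1 p. 12; §4.10 p. 57] -/
theorem exists_toAdelicGt_eq_twistFun (hc : c * c = 1) [Algebra.IsQuadraticExtension F E] {δ : E} (hcδ : c δ = -δ) (hδ : δ ≠ 0)
    (hΦ : ((Φ : GL (Fin n) E) : Matrix (Fin n) (Fin n) E)ᵀ.map c = (Φ : Matrix (Fin n) (Fin n) E)) (φ : GlobalTestFunctionGt F E n) :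
    ∃ ψ : GlobalTestFunctionGt F E n, (toAdelicGt ψ : GL (Fin n) (AdeleRing (𝓞 E) E) → ℂ) = twistFun (twistAdelic F E n Φ c) (toAdelicGt φ) := by
  obtain ⟨ψ, -, -, hψ⟩ := exists_twist_toAdelicGt_comp E n Φ c hc hcδ hδ hΦ φ
  exact ⟨ψ, funext fun g => by rw [hψ g, twistFun_apply]⟩

end Summit.HodgeConjecture.HodgeConjecture.Cruxes.H413.K2E1GlobalTestFunctionsTwistStable

end
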